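import Summits.Ventures.PercRepro.ProfileFlatUpsetHyperplane

/-!
# PercRepro — (G) IS TERMWISE ON `≥ 2r − 1` POINTS, FOR EVERY UP-SET OF FLATS (the trivial regime of (G))
(p10, gen 19; `proofs/P10-AVFULL.md` §27(g))

For a finite matroid `M` of rank `r` on `N ≥ 2r − 1` points and ANY up-set `U` of flats, every separated set `Z`
has a non-spanning complement (`E ∖ Z` spanning would put `E ∈ U`), so `#(E ∖ Z) ≤ r − 1`, `#Z ≥ N − r + 1` and the
term `2 #Z − N − 1 ≥ N − 2r + 1 ≥ 0` (`term_nonneg_of_mem_sepSets_large`); hence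
`sum_sepSets_nonneg_of_two_mul_rk_le`: the signed sum of (G) is non-negative.  In pointed language this is the
`2ρ ≤ N` regime of gen 17 (`capLimit_body_of_two_mul_rk_le`) — a new formulation in the up-set language, NOT new
coverage.  Together with the hyperplane case (108th) and the corank-two case (110th) it places the open part of
(G) at `N ≤ 2r − 2`.  Nothing here asserts (G) in general.
-/

open scoped Matroid

namespace PercRepro.Cogirth

open Finset ThmH Skew

variable {α : Type} [DecidableEq α] {M : Matroid α} [M.Finite]

omit [DecidableEq α] in
/-- The ground set is a flat. -/
theorem isFlatF_gr' : IsFlatF M (gr M) :=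
  ⟨Subset.refl _, Subset.antisymm (clF_subset_gr_fu _) (subset_clF_fu (Subset.refl _))⟩

/-- The complement of a separated set never spans: `#(E ∖ Z) + 1 ≤ r`. -/
theorem card_sdiff_add_one_le_rk_of_mem_sepSets {U : Finset (Finset α)} (hU : UpFlats M U) {Z : Finset α}
    (hZ : Z ∈ sepSets M U) : (gr M \ Z).card + 1 ≤ rk M (gr M) := by
  rw [mem_sepSets, mem_biIndepAll] at hZ
  obtain ⟨⟨hZg, _, hZc⟩, hin, hout⟩ := hZ
  by_contra hcon
  have hle : rk M (gr M \ Z) ≤ rk M (gr M) := rk_mono_fu sdiff_subset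
  have heq : rk M (gr M \ Z) = rk M (gr M) := by omega
  apply hout
  rw [clF_eq_gr_of_rk_eq sdiff_subset heq]
  exact hU.up _ hin _ isFlatF_gr' (clF_subset_gr_fu Z)

/-- On `N ≥ 2r − 1` points every term of (G) is non-negative. -/
theorem term_nonneg_of_mem_sepSets_large {U : Finset (Finset α)} (hU : UpFlats M U)
    (hN : 2 * rk M (gr M) ≤ (gr M).card + 1) {Z : Finset α} (hZ : Z ∈ sepSets M U) :
    0 ≤ 2 * (Z.card : ℤ) - (gr M).card - 1 := by
  have h1 := card_sdiff_add_one_le_rk_of_mem_sepSets hU hZ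
  have hZg : Z ⊆ gr M := (mem_biIndepAll.1 (mem_sepSets.1 hZ).1).1
  have hsum : Z.card + (gr M \ Z).card = (gr M).card := by
    rw [card_sdiff_of_subset hZg]; have := card_le_card hZg; omega
  have h2 : (Z.card : ℤ) + (gr M \ Z).card = (gr M).card := by exact_mod_cast hsum
  have h3 : ((gr M \ Z).card : ℤ) + 1 ≤ rk M (gr M) := by exact_mod_cast h1
  have h4 : 2 * (rk M (gr M) : ℤ) ≤ (gr M).card + 1 := by exact_mod_cast hN
  linarith

/-- **(G) ON `≥ 2r − 1` POINTS, FOR EVERY UP-SET OF FLATS** (termwise). -/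
theorem sum_sepSets_nonneg_of_two_mul_rk_le {U : Finset (Finset α)} (hU : UpFlats M U)
    (hN : 2 * rk M (gr M) ≤ (gr M).card + 1) :
    0 ≤ ∑ Z ∈ sepSets M U, (2 * (Z.card : ℤ) - (gr M).card - 1) :=
  sum_nonneg (fun _ hZ => term_nonneg_of_mem_sepSets_large hU hN hZ)

end PercRepro.Cogirth
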